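import Mathlib
import HarnessLib
import Summits.ResolutionOfSingularities.ResolutionOfSingularities.Theorems.WildQuotientsWildQuotientResolutionS1aKillCert
import Summits.ResolutionOfSingularities.ResolutionOfSingularities.Theorems.WildQuotientsWildQuotientResolutionS1aAuxOfRingData
import Summits.ResolutionOfSingularities.ResolutionOfSingularities.Theorems.WildQuotientsWildQuotientResolutionS1aKillGlue
import Summits.ResolutionOfSingularities.ResolutionOfSingularities.Theorems.WildQuotientsWildQuotientResolutionS1aStubInitialAtlas
import Summits.ResolutionOfSingularities.ResolutionOfSingularities.Theorems.WildQuotientsWildQuotientResolutionS1aVeroneseNormalisation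
import Summits.ResolutionOfSingularities.ResolutionOfSingularities.Theorems.WildQuotientsWildQuotientResolutionS1aVeroneseDegree
import Summits.ResolutionOfSingularities.ResolutionOfSingularities.Theorems.WildQuotientsWildQuotientResolutionS1aGoodShrink

/-!
# S1a — K AT A REGULAR MODEL FROM A COVER BY KILL-CERTIFICATE CHARTS WITH AGREEING FILTRATIONS (scheme level, trivial nodes)

[OURS · L1 W4.5c · lead-1 g10; FRAME-STATUS rev10 §4 item 2] — NOT statements of the manuscript; counted 0; AI-level work, weaker than expert review.
Crux stmt-ResolutionOfSingularities-17941 `CyclicQuotientFourfolds`, line `s1a-logminvertex` v10, registered research stub `stub_killTouchReachAux`.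
Route-independent. The first SCHEME-LEVEL instance schema of the attack form `KillAgreeReach` (p623915) fed by RING certificates (`KillCert.CobordantKillCert`,
p635979): on a REGULAR model every `G`-stable affine chart is a node with the TRIVIAL grading, so a cobordant kill certificate in `Γ(M.V, O)` IS principal
chart data, and agreement of two charts is agreement of the extended weighted filtrations of their frames — which for the (2,1) kill leaf is
`KillCert.weightedFiltration_eq_of_leaf` (p638258).

* `map_weightedFiltration` — weighted filtrations commute with ring maps: `𝒥ₙ(f)·A' = 𝒥ₙ(φ ∘ f)`;
* `GoodCharts.actOEquiv` — the action of `g` on `Γ(V, O)` as a ring automorphism (`actO g`, inverse `actO g⁻¹`); `actOEquiv_iterate` (`g^p = 1 ⇒ σ^[p] = id`);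
* ★★★ `GameFrame.GModel.exists_isPrincipalCentre_touch_of_certCover` — on a regular model `M` (Noetherian base, separated): finitely many stable affine charts
  `O_i` with weighted centres `f_i` in `Γ(M.V, O_i)` (K1′-regular, σ-adapted for `σ_i = actOEquiv g₀`) carrying a COBORDANT KILL CERTIFICATE for every
  admissible `(hp, hσp)`, whose weighted filtrations AGREE on every affine `U ≤ O_i ∩ O_j` (as extended ideals), and a closed non-empty `B ⊆ Z(M)` covered by
  the charts and containing their zero sets `V(f_i) ∩ O_i` ⇒ `∃ 𝒦 d, IsPrincipalCentre p M.act g₀ 𝒦 d ∧ (Z(M) ∩ supp 𝒦_d).Nonempty` — the conclusion of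
  `KillTouchReachAux` at `M`. (Node = trivial grading on `Γ(M.V, O_i)` (`exists_trivialGradedRing`); Veronese degrees by `veroneseNormalisation` and a common
  multiple; the kill clause by KC1; gluing by `KillGlue.exists_isPrincipalCentre_of_agree`.)
-/

set_option linter.dupNamespace false

noncomputable section

universe u v

open CategoryTheory Limits AlgebraicGeometry TopologicalSpace Topology Opposite
open Literature.AlgebraicGeometry.Resolution Literature.AlgebraicGeometry.RelativeSpec
open Summit.ResolutionOfSingularities.ResolutionOfSingularities.Theorems.WildQuotientResolution.S1
open Summit.ResolutionOfSingularities.ResolutionOfSingularities.Theorems.WildQuotientResolution.S1.NodeAtlas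
open Summit.ResolutionOfSingularities.ResolutionOfSingularities.Theorems.WildQuotientResolution.S1.ProducerStep
open Summit.ResolutionOfSingularities.ResolutionOfSingularities.Theorems.WildQuotientResolution.S1.CoarseChart
open Summit.ResolutionOfSingularities.ResolutionOfSingularities.Theorems.WildQuotientResolution.S1.ChartData
open Summit.ResolutionOfSingularities.ResolutionOfSingularities.Theorems.WildQuotientResolution.S1.KillGlue
open Summit.ResolutionOfSingularities.ResolutionOfSingularities.Theorems.WildQuotientResolution.S1.KillCert

/-! ## Weighted filtrations commute with ring maps -/

namespace Summit.ResolutionOfSingularities.ResolutionOfSingularities.Theorems.WildQuotientResolution.S1.KillCert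

/-- **`𝒥ₙ(f) · A' = 𝒥ₙ(φ ∘ f)`**: the extension of the weighted filtration of `(f, w)` along a ring map `φ : A → A'` is the weighted filtration of the
image frame. [folklore] -/
theorem map_weightedFiltration {A : Type u} {A' : Type v} [CommRing A] [CommRing A'] (φ : A →+* A') {c : ℕ} (f : Fin c → A) (w : Fin c → ℕ)
    (n : ℕ) : ((weightedFiltration f w).ideal n).map φ = (weightedFiltration (⇑φ ∘ f) w).ideal n := by
  rw [weightedFiltration_ideal, weightedFiltration_ideal, Ideal.map_span]
  congr 1
  ext x
  constructor
  · rintro ⟨_, ⟨α, hα, rfl⟩, rfl⟩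
    refine ⟨α, hα, ?_⟩
    rw [map_finsuppProd]
    simp only [map_pow, Function.comp_apply]
  · rintro ⟨α, hα, rfl⟩
    refine ⟨_, ⟨α, hα, rfl⟩, ?_⟩
    rw [map_finsuppProd]
    simp only [map_pow, Function.comp_apply]

end Summit.ResolutionOfSingularities.ResolutionOfSingularities.Theorems.WildQuotientResolution.S1.KillCert

/-! ## The action on a stable affine chart as a ring automorphism -/

namespace Summit.ResolutionOfSingularities.ResolutionOfSingularities.Theorems.WildQuotientResolution.S1.GoodCharts

variable {V Y : Scheme.{u}} {r : V ⟶ Y} {G : Type u} [Group G] (ρ : ActionOver r G) (O₁ : ρ.StableAffineOpens)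

/-- **The action of `g` on `Γ(V, O)` as a ring AUTOMORPHISM** (`actO g`, with inverse `actO g⁻¹`). [OURS · L1 W4.5c] -/
def actOEquiv (g : G) : Γ(V, O₁.1) ≃+* Γ(V, O₁.1) :=
  RingEquiv.ofRingHom (actO ρ O₁ g) (actO ρ O₁ g⁻¹)
    (RingHom.ext fun b => by rw [RingHom.comp_apply, actO_actO, mul_inv_cancel, actO_one]; rfl)
    (RingHom.ext fun b => by rw [RingHom.comp_apply, actO_actO, inv_mul_cancel, actO_one]; rfl)

/-- `actOEquiv g b = actO g b`. -/
@[simp] theorem actOEquiv_apply (g : G) (b : Γ(V, O₁.1)) : actOEquiv ρ O₁ g b = actO ρ O₁ g b := rfl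

/-- Iterates: `(actOEquiv g)^[k] = actO (g ^ k)`. -/
theorem actOEquiv_iterate (g : G) (k : ℕ) (b : Γ(V, O₁.1)) : (⇑(actOEquiv ρ O₁ g))^[k] b = actO ρ O₁ (g ^ k) b := by
  induction k generalizing b with
  | zero => rw [Function.iterate_zero, id_eq, pow_zero, actO_one]
  | succ k ih => rw [Function.iterate_succ_apply', ih, actOEquiv_apply, actO_actO, ← pow_succ']

/-- `g ^ p = 1 ⇒ (actOEquiv g)^[p] = id`. -/
theorem actOEquiv_iterate_eq_self {g : G} {p : ℕ} (hg : g ^ p = 1) (b : Γ(V, O₁.1)) : (⇑(actOEquiv ρ O₁ g))^[p] b = b := by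
  rw [actOEquiv_iterate, hg, actO_one]

end Summit.ResolutionOfSingularities.ResolutionOfSingularities.Theorems.WildQuotientResolution.S1.GoodCharts

/-! ## K at a regular model from a certificate cover -/

namespace Summit.ResolutionOfSingularities.ResolutionOfSingularities.Theorems.WildQuotientResolution.S1.GameFrame.GModel

open GoodCharts

variable {p : ℕ} {X' X₁ : Scheme.{0}} {q : X' ⟶ X₁} {G : Type} [Group G] {ρ : G →* Aut X'} {g₀ : G}

set_option maxHeartbeats 800000 in
/-- ★★★ **K AT A REGULAR MODEL FROM A COVER BY KILL-CERTIFICATE CHARTS WITH AGREEING FILTRATIONS.** Let `M` be a REGULAR model (Noetherian base,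
separated) with `g₀ ^ p = 1`. Given finitely many stable affine charts `O_i`, on each a weighted centre `f_i : Fin (c i) → Γ(M.V, O_i)` with positive weights
`w_i` (`0 < c i`, K1′-regular, σ-adapted for `σ_i = actOEquiv g₀`) carrying a cobordant kill certificate for every admissible `(hp, hσp)` (e.g. by
`KillCert.cobordantKillCert_smoothTransversalType`), such that the weighted filtrations AGREE on every affine `U ≤ O_i ∩ O_j` (as ideals extended to `Γ(M.V, U)`;
for leaf frames: `KillCert.weightedFiltration_eq_of_leaf` + `map_weightedFiltration`), and a CLOSED non-empty `B ⊆ Z(M)` covered by the `O_i` with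
`V(f_i) ∩ O_i ⊆ B`. Then some principal centre of `M` has support (`= B`) meeting the bad locus: the conclusion of `KillTouchReachAux` at `M`.
[OURS · L1 W4.5c · FRAME-STATUS rev10 §4 (2); NOT a statement of the manuscript] -/
theorem exists_isPrincipalCentre_touch_of_certCover [Finite G] (hp : p.Prime) (hG : ∀ g : G, g ∈ Subgroup.zpowers g₀) (hg₀ : g₀ ^ p = 1)
    (M : GModel p q G ρ g₀) (hNB : M.HasNoetherianBase) [M.V.IsSeparated] (hreg : Scheme.IsRegular M.V)
    {ι : Type} [Finite ι] (O : ι → M.act.StableAffineOpens) (hO : ∀ i, IsAffineOpen (O i).1)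
    (c : ι → ℕ) (f : ∀ i, Fin (c i) → Γ(M.V, (O i).1)) (w : ∀ i, Fin (c i) → ℕ) (hc : ∀ i, 0 < c i) (hw : ∀ i k, 0 < w i k)
    (hK1 : ∀ i, RingTheory.Sequence.IsRegular Γ(M.V, (O i).1) (List.ofFn (f i)))
    (hK1' : ∀ i, IsRegularRing (Γ(M.V, (O i).1) ⧸ Ideal.span (Set.range (f i))))
    (hσJ : ∀ i (n : ℕ), ((weightedFiltration (f i) (w i)).ideal n).map (actOEquiv M.act (O i) g₀ : Γ(M.V, (O i).1) →+* Γ(M.V, (O i).1)) ≤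
      (weightedFiltration (f i) (w i)).ideal n)
    (hcert : ∀ i (hp' : 0 < p) (hσp : ∀ x, (⇑(actOEquiv M.act (O i) g₀))^[p] x = x),
      ∃ g, CobordantKillCert (f i) (w i) (actOEquiv M.act (O i) g₀) (hσJ i) hp' hσp g)
    (hagree : ∀ i j (U : M.V.affineOpens) (hi : U.1 ≤ (O i).1) (hj : U.1 ≤ (O j).1) (n : ℕ),
      ((weightedFiltration (f i) (w i)).ideal n).map (M.V.presheaf.map (homOfLE hi).op).hom =
        ((weightedFiltration (f j) (w j)).ideal n).map (M.V.presheaf.map (homOfLE hj).op).hom)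
    {B : Set M.V} (hBc : IsClosed B) (hBbad : B ⊆ M.badLocus) (hBcov : B ⊆ ⋃ i, ((O i).1 : Set M.V)) (hBne : B.Nonempty)
    (hsupp : ∀ i, M.V.zeroLocus (U := (O i).1) (Set.range (f i)) ∩ ((O i).1 : Set M.V) ⊆ B) :
    ∃ (𝒦 : ReesFiltration M.V) (d : ℕ), IsPrincipalCentre p M.act g₀ 𝒦 d ∧ (M.badLocus ∩ ((𝒦.ideal d).support : Set M.V)).Nonempty := by
  classical
  haveI : IsLocallyNoetherian M.V := M.isLocallyNoetherian
  haveI : Fintype ι := Fintype.ofFinite ι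
  -- the trivial node on each chart
  have hnode : ∀ i, ∃ (𝒜 : (Π j : Fin 0, ZMod ((![] : Fin 0 → ℕ) j)) → AddSubgroup Γ(M.V, (O i).1)) (_ : GradedRing 𝒜),
      (∀ e, 𝒜 e = ⊤) ∧ ∃ e : Γ(M.V, (O i).1) ≃+* ↥(𝒜 0), ∀ b, ((e b : ↥(𝒜 0)) : Γ(M.V, (O i).1)) = b :=
    fun i => exists_trivialGradedRing _ _
  choose 𝒜 gr h𝒜 e he using hnode
  -- Veronese degrees, and a common one
  have hver₀ : ∀ i, ∃ d : ℕ, letI := gr i; VeroneseNormalised (𝒜 i) (f i) (w i) d := by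
    intro i
    letI := gr i
    refine Veronese.veroneseNormalisation _ _ (𝒜 i) ⟨∅, ?_⟩ (c i) (f i) (fun _ => 0) (w i) (fun k => by rw [h𝒜 i]; trivial)
    rw [h𝒜 i 0, Finset.coe_empty, Set.union_empty]
    exact top_le_iff.mp fun x _ => Subring.subset_closure trivial
  choose d hd using hver₀
  let D : ℕ := ∏ i, d i
  have hdpos : ∀ i, 0 < d i := fun i => by letI := gr i; exact (hd i).1
  have hD : ∀ i, letI := gr i; VeroneseNormalised (𝒜 i) (f i) (w i) D := by
    intro i
    letI := gr i
    have e1 : D = d i * ∏ j ∈ Finset.univ.erase i, d j := (Finset.mul_prod_erase Finset.univ d (Finset.mem_univ i)).symm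
    rw [e1]
    exact CoarseChart.veroneseNormalised_mul (𝒜 i) (f i) (w i) (hd i) (Finset.prod_pos fun j _ => hdpos j)
  have hDpos : 0 < D := Finset.prod_pos fun j _ => hdpos j
  -- the chart filtrations
  let K : ∀ i, IdealFiltration Γ(M.V, (O i).1) := fun i => weightedFiltration (f i) (w i)
  let 𝒦 : ι → ReesFiltration M.V := fun i => chartFiltration (O i).1 (K i)
  have h𝒦O : ∀ i n, ((𝒦 i).filtration ⟨(O i).1, hO i⟩).ideal n = (weightedFiltration (f i) (w i)).ideal n := fun i n =>
    filtration_chartFiltration (O i).1 (hO i) (K i) n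
  have h𝒦O' : ∀ i n, ((𝒦 i).filtration ⟨(O i).1, hO i⟩).ideal n =
      (letI := gr i; ((traceFiltration (𝒜 i) (f i) (w i)).ideal n).comap ((e i : Γ(M.V, (O i).1) →+* ↥(𝒜 i 0)))) := by
    intro i n
    letI := gr i
    rw [h𝒦O]
    ext t
    rw [Ideal.mem_comap, mem_traceFiltration_iff, RingHom.coe_coe, he]
  -- each chart is a principal-centre chart
  have hprin : ∀ i, IsPrincipalCentreChart p M.act g₀ (𝒦 i) D (O i) := by
    intro i
    letI := gr i
    haveI : IsNoetherianRing Γ(M.V, (O i).1) := IsLocallyNoetherian.component_noetherian ⟨(O i).1, hO i⟩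
    have hregi : IsRegularRing Γ(M.V, (O i).1) := hreg.isRegularRing_of_isAffineOpen (hO i)
    have hσp : ∀ x, (⇑(actOEquiv M.act (O i) g₀))^[p] x = x := fun x => actOEquiv_iterate_eq_self M.act (O i) hg₀ x
    have htame : IsTameNode p Γ(M.V, (O i).1) (𝒜 i) (actOEquiv M.act (O i) g₀) := by
      refine ⟨inferInstance, hregi, ?_, ?_, ?_, hσp⟩
      · exact ⟨∅, fun _ h => absurd h (Finset.notMem_empty _), inferInstance⟩
      · refine ⟨∅, eq_top_iff.mpr fun b _ => Subring.subset_closure (Or.inl ?_)⟩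
        rw [h𝒜 i 0]; exact AddSubgroup.mem_top b
      · intro d' b _; rw [h𝒜 i d']; exact AddSubgroup.mem_top _
    refine ⟨hO i, 0, ![], Γ(M.V, (O i).1), inferInstance, 𝒜 i, gr i, actOEquiv M.act (O i) g₀, e i, htame, fun t => ?_, c i, f i,
      fun _ => 0, w i, hc i, fun k => ?_, hw i, hK1 i, hK1' i, hσJ i, h𝒦O' i, hD i, ?_⟩
    · rw [he, he]; rfl
    · rw [h𝒜 i]; trivial
    · intro hp' hσp' d' b hb hσb hd'
      obtain ⟨g, hg⟩ := hcert i hp' hσp'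
      exact isPrincipal_augmentationIdeal_sigmaChart_of_cert (f i) (w i) _ (hσJ i) hp' hσp' (𝒜 i) hd' b hb hσb hg
  -- agreement on common affine opens
  have hagree' : ∀ i j (U : M.V.affineOpens), U.1 ≤ (O i).1 → U.1 ≤ (O j).1 →
      ∀ n, ((𝒦 i).filtration U).ideal n = ((𝒦 j).filtration U).ideal n := by
    intro i j U hi hj n
    have ei : ((𝒦 i).filtration U).ideal n = ((weightedFiltration (f i) (w i)).ideal n).map (M.V.presheaf.map (homOfLE hi).op).hom := by
      rw [← h𝒦O i n, ReesFiltration.filtration_ideal, ReesFiltration.filtration_ideal]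
      exact (((𝒦 i).ideal n).map_ideal (U := U) (V := ⟨(O i).1, hO i⟩) hi).symm
    have ej : ((𝒦 j).filtration U).ideal n = ((weightedFiltration (f j) (w j)).ideal n).map (M.V.presheaf.map (homOfLE hj).op).hom := by
      rw [← h𝒦O j n, ReesFiltration.filtration_ideal, ReesFiltration.filtration_ideal]
      exact (((𝒦 j).ideal n).map_ideal (U := U) (V := ⟨(O j).1, hO j⟩) hj).symm
    rw [ei, ej, hagree i j U hi hj n]
  -- supports inside `B`
  have hsupp' : ∀ i, ((((𝒦 i).ideal D).support : Set M.V)) ∩ ((O i).1 : Set M.V) ⊆ B := by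
    intro i x ⟨hx, hxO⟩
    have hZ : x ∈ M.V.zeroLocus (U := (O i).1) (((K i).ideal D : Ideal Γ(M.V, (O i).1)) : Set Γ(M.V, (O i).1)) :=
      (mem_support_chartFiltration_iff (O i).1 (hO i) (K i) D hxO).mp hx
    refine hsupp i ⟨?_, hxO⟩
    -- `V(𝒥_D) ⊆ V(I^D) = V(I) = V(range f)`
    have hID : Ideal.span (Set.range (f i)) ^ D ≤ (K i).ideal D := by
      have h1 : Ideal.span (Set.range (f i)) ≤ (K i).ideal 1 := by
        rw [Ideal.span_le]
        rintro _ ⟨k, rfl⟩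
        exact (weightedFiltration (f i) (w i)).antitone (hw i k) (mem_weightedFiltration_ideal (f i) (w i) k)
      refine (Ideal.pow_right_mono h1 D).trans ?_
      have := Veronese.idealFiltration_pow_le (K i) 1 D
      rwa [one_mul] at this
    have h2 : x ∈ M.V.zeroLocus (U := (O i).1) ((Ideal.span (Set.range (f i)) ^ D : Ideal Γ(M.V, (O i).1)) : Set Γ(M.V, (O i).1)) :=
      M.V.zeroLocus_mono (SetLike.coe_subset_coe.mpr hID) hZ
    rw [← Scheme.zeroLocus_radical, Ideal.radical_pow _ hDpos.ne', Scheme.zeroLocus_radical, Scheme.zeroLocus_span] at h2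
    exact h2
  obtain ⟨J, hJ, hJsupp, -⟩ := exists_isPrincipalCentre_of_agree hp hG M hNB O 𝒦 hDpos hprin hagree' hBc hBbad hBcov hsupp'
  obtain ⟨v, hv⟩ := hBne
  exact ⟨J, D, hJ, v, hBbad hv, by rw [hJsupp]; exact hv⟩

end Summit.ResolutionOfSingularities.ResolutionOfSingularities.Theorems.WildQuotientResolution.S1.GameFrame.GModel

end
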